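import Summits.Ventures.PercRepro.RLSRulePlus

/-!
# The flats of the core are small: `|F| ≤ 2^q − 1` for every rank-`q` flat (night-3, gen 4)

On a core matroid (`Core M p`: simple, rank `p`, coloop-free, every element `e` with an `e`-free partition
`E ∖ e = A ⊔ A'`, `e ∉ cl A`, `e ∉ cl A'`) a rank-`q` flat `F` splits, for any `e ∈ F`, as
`F ∖ e = (F ∩ A) ⊔ (F ∩ A')`, and the closure of each part is a flat INSIDE `F` that avoids `e`, hence of rank
`< q` (`exists_cover_erase_of_core`).  So `f(q) ≤ 2 f(q − 1) + 1` for the largest size `f(q)` of a rank-`q` flat,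
and by induction **`card_add_one_le_two_pow_of_core`**: `|F| + 1 ≤ 2^q`.  (Rank `3`: `≤ 7`, sharpened to `6` in
`RLSRuleCoreSix`; rank `4`: `≤ 15`.)  The lead's (rm)(4)(i) request: the recursion in the kernel, at every rank.
Imports `RLSRulePlus`.  Axioms: standard.
-/

open scoped Matroid

namespace PercRepro

namespace NightThree

open Finset ThmH PerFlat

variable {α : Type*} [DecidableEq α] {M : Matroid α} [M.Finite]

omit [DecidableEq α] in
/-- The closure of a subset of a flat `F` that misses a point `e ∈ F` has rank `< rank F`. -/
theorem eRk_lt_of_subset_flat_of_notMem_closure {F B : Finset α} {q : ℕ} (hF : F ∈ flatsQ M q) (hB : B ⊆ F)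
    {e : α} (he : e ∈ F) (heB : e ∉ M.closure (B : Set α)) : M.eRk (B : Set α) < (q : ℕ∞) := by
  obtain ⟨_, hflat, hq⟩ := mem_flatsQ.1 hF
  by_contra hle
  push Not at hle
  have hcl := closure_eq_of_subset_flat hflat (Finset.coe_subset.2 hB) (Finset.finite_toSet _) (by rw [hq]; exact hle)
  exact heB (by rw [hcl]; exact Finset.mem_coe.2 he)

open scoped Classical in
/-- **The cover of `F ∖ e` by two smaller flats.**  For a rank-`q` flat `F` of the core and `e ∈ F` there are flats
`F₁, F₂ ⊆ F` of ranks `< q` with `F ∖ {e} ⊆ F₁ ∪ F₂`. -/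
theorem exists_cover_erase_of_core {p : ℕ} (hc : Core M p) {F : Finset α} {q : ℕ} (hF : F ∈ flatsQ M q) {e : α}
    (he : e ∈ F) :
    ∃ F₁ F₂ : Finset α, ∃ r₁ r₂ : ℕ, r₁ < q ∧ r₂ < q ∧ F₁ ∈ flatsQ M r₁ ∧ F₂ ∈ flatsQ M r₂ ∧
      F₁ ⊆ F ∧ F₂ ⊆ F ∧ F.erase e ⊆ F₁ ∪ F₂ := by
  obtain ⟨hFE, hflat, hq⟩ := mem_flatsQ.1 hF
  have heE : e ∈ M.E := by rw [← coe_gr M]; exact Finset.mem_coe.2 (hFE he)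
  obtain ⟨A, hAE, heA, heA'⟩ := hc.2.2.2 e heE
  set A₁ := (F.erase e).filter (fun x => x ∈ A) with hA₁
  set A₂ := (F.erase e).filter (fun x => x ∉ A) with hA₂
  have hA₁F : A₁ ⊆ F := (Finset.filter_subset _ _).trans (Finset.erase_subset _ _)
  have hA₂F : A₂ ⊆ F := (Finset.filter_subset _ _).trans (Finset.erase_subset _ _)
  have hFE' : (F : Set α) ⊆ M.E := by rw [← coe_gr M]; exact Finset.coe_subset.2 hFE
  -- `e` is outside both closures
  have he1 : e ∉ M.closure (A₁ : Set α) := fun h =>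
    heA (M.closure_mono (fun x hx => (Finset.mem_filter.1 (Finset.mem_coe.1 hx)).2) h)
  have he2 : e ∉ M.closure (A₂ : Set α) := fun h =>
    heA' (M.closure_mono (fun x hx => by
      have hx' := Finset.mem_filter.1 (Finset.mem_coe.1 hx)
      have hxe := Finset.mem_erase.1 hx'.1
      exact ⟨⟨hFE' (Finset.mem_coe.2 hxe.2), fun h => hxe.1 (Set.mem_singleton_iff.1 h)⟩, hx'.2⟩) h)
  -- the closures are flats inside `F`
  have hcl1 : M.closure (A₁ : Set α) ⊆ F := by
    rw [← hflat.closure]; exact M.closure_subset_closure (Finset.coe_subset.2 hA₁F)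
  have hcl2 : M.closure (A₂ : Set α) ⊆ F := by
    rw [← hflat.closure]; exact M.closure_subset_closure (Finset.coe_subset.2 hA₂F)
  obtain ⟨r₁, hr₁, _⟩ := eRk_eq_nat M (clF M A₁)
  obtain ⟨r₂, hr₂, _⟩ := eRk_eq_nat M (clF M A₂)
  have hlt1 := eRk_lt_of_subset_flat_of_notMem_closure hF hA₁F he he1
  have hlt2 := eRk_lt_of_subset_flat_of_notMem_closure hF hA₂F he he2
  rw [← M.eRk_closure_eq, ← coe_clF, hr₁] at hlt1
  rw [← M.eRk_closure_eq, ← coe_clF, hr₂] at hlt2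
  refine ⟨clF M A₁, clF M A₂, r₁, r₂, by exact_mod_cast hlt1, by exact_mod_cast hlt2, ?_, ?_, ?_, ?_, ?_⟩
  · rw [mem_flatsQ]
    refine ⟨?_, by rw [coe_clF]; exact M.isFlat_closure _, hr₁⟩
    rw [← Finset.coe_subset, coe_clF, coe_gr]; exact M.closure_subset_ground _
  · rw [mem_flatsQ]
    refine ⟨?_, by rw [coe_clF]; exact M.isFlat_closure _, hr₂⟩
    rw [← Finset.coe_subset, coe_clF, coe_gr]; exact M.closure_subset_ground _
  · rw [← Finset.coe_subset, coe_clF]; exact hcl1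
  · rw [← Finset.coe_subset, coe_clF]; exact hcl2
  · intro x hx
    rw [Finset.mem_union]
    by_cases hxA : x ∈ A
    · left
      have : x ∈ A₁ := Finset.mem_filter.2 ⟨hx, hxA⟩
      rw [← Finset.mem_coe, coe_clF]
      exact M.subset_closure _ ((Finset.coe_subset.2 hA₁F).trans hFE') (Finset.mem_coe.2 this)
    · right
      have : x ∈ A₂ := Finset.mem_filter.2 ⟨hx, hxA⟩
      rw [← Finset.mem_coe, coe_clF]
      exact M.subset_closure _ ((Finset.coe_subset.2 hA₂F).trans hFE') (Finset.mem_coe.2 this)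

/-- **The flats of the core are small**: a rank-`q` flat has at most `2^q − 1` points (`|F| + 1 ≤ 2^q`). -/
theorem card_add_one_le_two_pow_of_core {p : ℕ} (hc : Core M p) :
    ∀ (q : ℕ) (F : Finset α), F ∈ flatsQ M q → F.card + 1 ≤ 2 ^ q := by
  intro q
  induction q using Nat.strong_induction_on with
  | _ q ih =>
    intro F hF
    rcases F.eq_empty_or_nonempty with hemp | ⟨e, he⟩
    · rw [hemp, Finset.card_empty]; exact Nat.one_le_two_pow
    obtain ⟨F₁, F₂, r₁, r₂, hr₁, hr₂, hF₁, hF₂, _, _, hcov⟩ := exists_cover_erase_of_core hc hF he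
    have h1 := ih r₁ hr₁ F₁ hF₁
    have h2 := ih r₂ hr₂ F₂ hF₂
    have hpow1 : 2 ^ r₁ ≤ 2 ^ (q - 1) := Nat.pow_le_pow_right (by norm_num) (by omega)
    have hpow2 : 2 ^ r₂ ≤ 2 ^ (q - 1) := Nat.pow_le_pow_right (by norm_num) (by omega)
    have hq : 2 ^ q = 2 * 2 ^ (q - 1) := by
      obtain ⟨q', rfl⟩ : ∃ q', q = q' + 1 := ⟨q - 1, by omega⟩
      rw [Nat.add_sub_cancel, pow_succ]; ring
    have hcard : F.card = (F.erase e).card + 1 := by rw [Finset.card_erase_add_one he]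
    have hle : (F.erase e).card ≤ F₁.card + F₂.card :=
      (Finset.card_le_card hcov).trans (Finset.card_union_le _ _)
    omega

/-- Rank `4`: every rank-`4` flat of the core has at most `15` points. -/
theorem card_le_fifteen_of_core {p : ℕ} (hc : Core M p) {F : Finset α} (hF : F ∈ flatsQ M 4) : F.card ≤ 15 := by
  have := card_add_one_le_two_pow_of_core hc 4 F hF
  omega

end NightThree

end PercRepro
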